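import Literature.NumberTheory.Automorphic.UnramifiedHeckeScalarsFlathProofs
import Literature.RepresentationTheory.Semisimple.SubrepresentationEquiv
import HarnessLib

/-!
# The cyclic module of a spherical Hecke eigenvector in a unitary representation is irreducible

Topic `NumberTheory/Automorphic`; theorems only (no definition, no named fact). This is the
first, purely functional-analytic, layer of the bridge between the **local-component** language
(`HasLocalComponentAt`: an irreducible smooth representation of `GL_n(K_v)` embedded
equivariantly in an automorphic representation) and the **Satake-parameter** language
(`HasSatakeParameterAt`: a non-zero vector fixed by `GL_n(𝒪_v)` on which the Hecke operators
`T_{v,i}` act by prescribed scalars) in which the parts of the Jacquet–Langlands correspondence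
are vendored (`Literature.NumberTheory.Automorphic.JacquetLanglandsParts`; Gelbart,
*Automorphic forms on adele groups* (1975), Thm. 10.5, speaks of local components
`π'_v ≅ π_v`, the tree of Satake parameters).

## The theorem

Let `σ` be a **unitary** representation of a group `G` on a complex Hilbert space `H` (no
continuity in `G` is needed), `K ≤ G` a subgroup all of whose double cosets `KgK` are finite
unions of left cosets (e.g. `K` compact open), and `0 ≠ f ∈ H^K` a `K`-fixed vector which is an
**eigenvector of every Hecke operator** `[KgK]`, `g ∈ G` (`heckeOperator`). Let
`S = span_ℂ {σ(g) f}` be the cyclic subrepresentation generated by `f` (a `Subrepresentation`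
of the algebraic representation `σ.toRepresentation`; no closure is taken). Then

* `exists_eq_smul_of_mem_span_of_mem_fixedPoints`: `S^K = ℂ f` — a `K`-fixed vector of `S` is a
  multiple of `f` (compare `⟪z, σ(g) f⟫ = #(KgK/K)⁻¹ ⟪z, [KgK] f⟫` for `z ∈ H^K`,
  `inner_heckeOperator_apply_left`);
* `isAtom_subrepresentation_span`, `isIrreducible_toRepresentation_span`: `S` is an
  **irreducible** representation of `G` (an atom of the lattice of subrepresentations): a
  subrepresentation `W < S` contains no non-zero `K`-fixed vector (else it contains `f`), hence
  the finite averages `∑_{x ∈ K/U} σ(x) w ∈ W^K` of its (automatically `U`-smooth, `[K:U] < ∞`)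
  vectors vanish, which by unitarity gives `⟪f, w⟫ = 0` for all `w ∈ W`, then `W ⊥ σ(G) f`,
  `W ⊥ S ⊇ W`, `W = 0`;
* `isSmooth_toRepresentation_span`: if `G` is a topological group and `K` is open, `S` is a
  smooth representation (`Representation.IsSmooth`).

This is the standard argument that the `G_v`-module generated by a spherical vector of an
irreducible unitary representation with one-dimensional `K_v`-invariants is irreducible
(Deitmar–Echterhoff, *Principles of harmonic analysis* (2014), Thm. 11.2.4 and its proof, for
Gelfand pairs; Bump, *Automorphic forms and representations* (1997), §3.3–3.4 and Thm. 4.6.2;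
Cartier, Corvallis (1979), §IV), written for the finite-sum Hecke operators of the tree and
without any admissibility, tensor-product theorem or integration. Combined with the proved
scalar action of the spherical Hecke algebras on cuspidal representations
(`Flath1979_heckeOperatorAt_sphericalLevelAt_eq_smul_holds`) it produces, from a Satake
eigenvector of a cuspidal automorphic representation `Π` at `v`, an irreducible smooth
unramified representation of `GL_n(K_v)` occurring in `Π` as a local component.

## References

* A. Deitmar, S. Echterhoff, *Principles of harmonic analysis*, 2nd ed. (2014), Thm. 11.2.4
  (pp. 266–267) [DeitmarEchterhoff2014].
* D. Bump, *Automorphic forms and representations* (1997), §3.3–3.4, Thm. 4.6.2 [Bump1997].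
* P. Cartier, *Representations of 𝔭-adic groups: a survey*, Corvallis (1979), §IV
  [CartierCorvallis1979].
-/

noncomputable section

open scoped InnerProductSpace ComplexConjugate

namespace Literature.NumberTheory.Automorphic

/-! ### Cyclic subrepresentations and finite averaging (algebraic) -/

section Algebra

variable {k G V : Type*} [CommRing k] [Group G] [AddCommGroup V] [Module k V]

/-- The span of the orbit `{ρ(g) f}` of a vector is a subrepresentation (the cyclic
subrepresentation generated by `f`; Bump (1997), §3.3). [folklore] -/
theorem exists_subrepresentation_toSubmodule_eq_span (ρ : Representation k G V) (f : V) :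
    ∃ S : Subrepresentation ρ,
      S.toSubmodule = Submodule.span k (Set.range fun g : G => ρ g f) := by
  refine ⟨⟨Submodule.span k (Set.range fun g : G => ρ g f), fun g v hv => ?_⟩, rfl⟩
  induction hv using Submodule.span_induction with
  | mem x hx =>
    obtain ⟨g', rfl⟩ := hx
    refine Submodule.subset_span ⟨g * g', ?_⟩
    change ρ (g * g') f = ρ g (ρ g' f)
    rw [map_mul, Module.End.mul_apply]
  | zero => rw [map_zero]; exact Submodule.zero_mem _
  | add x y _ _ hx hy => rw [map_add]; exact Submodule.add_mem _ hx hy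
  | smul c x _ hx => rw [map_smul]; exact Submodule.smul_mem _ c hx

/-- The cyclic subrepresentation contains its generator. [folklore] -/
theorem mem_of_toSubmodule_eq_span {ρ : Representation k G V} {f : V} {S : Subrepresentation ρ}
    (hS : S.toSubmodule = Submodule.span k (Set.range fun g : G => ρ g f)) : f ∈ S := by
  change f ∈ S.toSubmodule
  rw [hS]
  exact Submodule.subset_span ⟨1, show ρ 1 f = f by rw [map_one]; rfl⟩

/-- The cyclic subrepresentation generated by `f` is the least subrepresentation containing `f`.
[folklore] -/
theorem le_of_toSubmodule_eq_span {ρ : Representation k G V} {f : V} {S : Subrepresentation ρ}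
    (hS : S.toSubmodule = Submodule.span k (Set.range fun g : G => ρ g f))
    (S' : Subrepresentation ρ) (hf : f ∈ S') : S ≤ S' := by
  intro x hx
  change x ∈ S.toSubmodule at hx
  rw [hS] at hx
  change x ∈ S'.toSubmodule
  refine (Submodule.span_le.2 ?_) hx
  rintro _ ⟨g, rfl⟩
  exact S'.apply_mem_toSubmodule g hf

/-- A translate `ρ(g) f` of a `K`-fixed vector is fixed by the stabiliser of `gK` in `K`
(`= K ∩ gKg⁻¹`). [folklore] -/
theorem apply_apply_eq_of_mem_stabilizer (ρ : Representation k G V) (K : Subgroup G) {f : V}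
    (hf : f ∈ ρ.fixedPoints K) (g : G) {u : K}
    (hu : u ∈ MulAction.stabilizer K (g : G ⧸ K)) : ρ (u : G) (ρ g f) = ρ g f := by
  rw [MulAction.mem_stabilizer_iff] at hu
  have hu' : (((u : G) * g : G) : G ⧸ K) = (g : G ⧸ K) := hu
  rw [QuotientGroup.eq] at hu'
  have hmem : g⁻¹ * (u : G) * g ∈ K := by
    have := inv_mem hu'
    convert this using 1
    group
  have key : ρ (g⁻¹ * (u : G) * g) f = f := (ρ.mem_fixedPoints K f).1 hf _ hmem
  calc ρ (u : G) (ρ g f) = ρ g (ρ (g⁻¹ * (u : G) * g) f) := by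
        rw [← Module.End.mul_apply, ← map_mul, ← Module.End.mul_apply, ← map_mul]
        congr 2
        group
    _ = ρ g f := by rw [key]

/-- The stabiliser in `K` of a point `gK ∈ G ⧸ K` with finite `K`-orbit has finite (non-zero)
index in `K` (orbit–stabiliser; Mathlib `MulAction.index_stabilizer`). [folklore] -/
theorem index_stabilizer_ne_zero (K : Subgroup G) (g : G)
    (hfin : (MulAction.orbit K (g : G ⧸ K)).Finite) :
    (MulAction.stabilizer K (g : G ⧸ K)).index ≠ 0 := by
  rw [MulAction.index_stabilizer]
  exact ((Set.ncard_pos hfin).2 ⟨_, MulAction.mem_orbit_self _⟩).ne'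

/-- **Finite averaging.** If `w` is fixed by a subgroup `U ≤ K` of finite index, then the sum of
its translates over a set of representatives of `K ⧸ U` is `K`-fixed; the representatives form a
non-empty finite subset of `K` (Bump (1997), §3.3; Bushnell–Henniart §2.1, the projector `e_K`
on smooth vectors). [folklore] -/
theorem exists_finset_sum_mem_fixedPoints (ρ : Representation k G V) (K : Subgroup G)
    (U : Subgroup K) (hU : U.index ≠ 0) {w : V} (hw : ∀ u ∈ U, ρ (u : G) w = w) :
    ∃ s : Finset G, s.Nonempty ∧ (∀ x ∈ s, x ∈ K) ∧ (∑ x ∈ s, ρ x w) ∈ ρ.fixedPoints K := by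
  classical
  haveI : U.FiniteIndex := ⟨hU⟩
  letI : Fintype (K ⧸ U) := Subgroup.fintypeQuotientOfFiniteIndex
  let r : K ⧸ U → G := fun q => ((q.out : K) : G)
  have hr : Function.Injective r := fun q q' h => by
    have h' : q.out = q'.out := Subtype.ext h
    rw [← QuotientGroup.out_eq' q, ← QuotientGroup.out_eq' q', h']
  refine ⟨Finset.univ.image r, Finset.univ_nonempty.image r, fun x hx => ?_, ?_⟩
  · obtain ⟨q, -, rfl⟩ := Finset.mem_image.1 hx
    exact (q.out : K).2
  · rw [Finset.sum_image fun q _ q' _ h => hr h, Representation.mem_fixedPoints]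
    intro x hx
    rw [map_sum]
    refine Fintype.sum_equiv (MulAction.toPerm (⟨x, hx⟩ : K)) _ _ fun q => ?_
    obtain ⟨h, H⟩ := QuotientGroup.mk_out_eq_mul U ((⟨x, hx⟩ : K) * q.out)
    have e1 : (⟨x, hx⟩ : K) • q = (((⟨x, hx⟩ : K) * q.out : K) : K ⧸ U) := by
      conv_lhs => rw [← QuotientGroup.out_eq' q]
      rfl
    rw [MulAction.toPerm_apply, e1]
    set y : K := (⟨x, hx⟩ : K) * q.out with hy
    change ρ x (ρ ((q.out : K) : G) w) = ρ ((((y : K ⧸ U).out : K) : G)) w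
    rw [H, Subgroup.coe_mul, hy, Subgroup.coe_mul, map_mul, map_mul, Module.End.mul_apply,
      Module.End.mul_apply, hw _ h.2]

/-- A vector in the span of the translates of a `K`-fixed vector `f` is fixed by a subgroup of
`K` of finite index, provided the double cosets `KgK` are finite unions of left cosets: the
intersection of the stabilisers in `K` of the finitely many `g_i K` involved. [folklore] -/
theorem exists_subgroup_index_ne_zero_of_mem_span (ρ : Representation k G V) (K : Subgroup G)
    (hfin : ∀ g : G, (MulAction.orbit K (g : G ⧸ K)).Finite) {f : V}
    (hf : f ∈ ρ.fixedPoints K) {w : V}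
    (hw : w ∈ Submodule.span k (Set.range fun g : G => ρ g f)) :
    ∃ U : Subgroup K, U.index ≠ 0 ∧ ∀ u ∈ U, ρ (u : G) w = w := by
  classical
  obtain ⟨c, rfl⟩ := (Finsupp.mem_span_range_iff_exists_finsupp).1 hw
  refine ⟨⨅ i : c.support, MulAction.stabilizer K ((i : G) : G ⧸ K), ?_, fun u hu => ?_⟩
  · exact Subgroup.index_iInf_ne_zero fun i => index_stabilizer_ne_zero K (i : G) (hfin i)
  · rw [Finsupp.sum, map_sum]
    refine Finset.sum_congr rfl fun g hg => ?_
    rw [map_smul]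
    congr 1
    exact apply_apply_eq_of_mem_stabilizer ρ K hf g ((Subgroup.mem_iInf.1 hu) ⟨g, hg⟩)

variable [TopologicalSpace G] [SeparatelyContinuousMul G]

/-- Every vector of the cyclic subrepresentation generated by a vector fixed by an *open*
subgroup is smooth (translates and finite linear combinations of smooth vectors are smooth;
Bernstein–Zelevinsky (1976), §2.1). [folklore] -/
theorem isSmoothVector_of_mem_span (ρ : Representation k G V) (K : Subgroup G)
    (hK : IsOpen (K : Set G)) {f : V} (hf : f ∈ ρ.fixedPoints K) {w : V}
    (hw : w ∈ Submodule.span k (Set.range fun g : G => ρ g f)) : ρ.IsSmoothVector w := by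
  induction hw using Submodule.span_induction with
  | mem x hx =>
    obtain ⟨g, rfl⟩ := hx
    exact Representation.IsSmoothVector.apply ρ g (ρ.isSmoothVector_of_mem_fixedPoints hK hf)
  | zero => exact ρ.isSmoothVector_zero
  | add x y _ _ hx hy => exact hx.add ρ hy
  | smul c x _ hx => exact hx.smul ρ c

/-- The cyclic subrepresentation generated by a vector fixed by an open subgroup is a **smooth**
representation (Bernstein–Zelevinsky (1976), §2.1; Bump (1997), §3.3). [folklore] -/
theorem isSmooth_toRepresentation_span (ρ : Representation k G V) (K : Subgroup G)
    (hK : IsOpen (K : Set G)) {f : V} (hf : f ∈ ρ.fixedPoints K) (S : Subrepresentation ρ)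
    (hS : S.toSubmodule = Submodule.span k (Set.range fun g : G => ρ g f)) :
    S.toRepresentation.IsSmooth := by
  intro v
  have : ((S.toRepresentation).stabilizerSubgroup v : Set G) =
      (ρ.stabilizerSubgroup (v : V) : Set G) := by
    ext g
    simp only [SetLike.mem_coe, Representation.mem_stabilizerSubgroup,
      Subrepresentation.toRepresentation, MonoidHom.coe_mk, OneHom.coe_mk, Subtype.ext_iff,
      LinearMap.coe_restrict_apply]
  rw [Representation.IsSmoothVector, this]
  have hv : (v : V) ∈ Submodule.span k (Set.range fun g : G => ρ g f) := by
    rw [← hS]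
    exact v.2
  exact isSmoothVector_of_mem_span ρ K hK hf hv

end Algebra

/-! ### Unitary representations: the line of `K`-fixed vectors and irreducibility -/

section Unitary

variable {G H : Type*} [Group G] [NormedAddCommGroup H] [InnerProductSpace ℂ H] [CompleteSpace H]

/-- Unitarity: `⟪f, σ(x) w⟫ = ⟪f, w⟫` for `f` fixed by `K` and `x ∈ K`. [folklore] -/
theorem inner_apply_eq_of_mem_fixedPoints (σ : ContRepresentation ℂ G H) (hU : σ.IsUnitary)
    (K : Subgroup G) {f : H} (hf : f ∈ σ.toRepresentation.fixedPoints K) {x : G} (hx : x ∈ K)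
    (w : H) : ⟪f, σ x w⟫_ℂ = ⟪f, w⟫_ℂ := by
  have hfx : σ x⁻¹ f = f := (σ.toRepresentation.mem_fixedPoints K f).1 hf _ (inv_mem hx)
  have e : σ x⁻¹ (σ x w) = w := by
    change (σ x⁻¹ * σ x) w = w
    rw [← map_mul, inv_mul_cancel, map_one]
    rfl
  rw [← hU.inner_map_map x⁻¹ f (σ x w), hfx, e]

/-- Unitarity: `⟪σ(g) f, w⟫ = ⟪f, σ(g⁻¹) w⟫`. [folklore] -/
theorem inner_apply_left_eq (σ : ContRepresentation ℂ G H) (hU : σ.IsUnitary) (g : G)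
    (f w : H) : ⟪σ g f, w⟫_ℂ = ⟪f, σ g⁻¹ w⟫_ℂ := by
  have e : σ g⁻¹ (σ g f) = f := by
    change (σ g⁻¹ * σ g) f = f
    rw [← map_mul, inv_mul_cancel, map_one]
    rfl
  rw [← hU.inner_map_map g⁻¹ (σ g f) w, e]

/-- In a unitary representation, if a `K`-stable submodule `W` contains no non-zero `K`-fixed
vector, then every `w ∈ W` fixed by a finite-index subgroup of `K` is orthogonal to every
`K`-fixed vector `f`: the finite average `∑_{x ∈ K/U} σ(x) w` lies in `W^K = 0` and has inner
product `[K:U] ⟪f, w⟫` with `f` (Deitmar–Echterhoff (2014), proof of Thm. 11.2.4). [folklore] -/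
theorem inner_eq_zero_of_forall_mem_fixedPoints_eq_zero (σ : ContRepresentation ℂ G H)
    (hU : σ.IsUnitary) (K : Subgroup G) {f : H} (hf : f ∈ σ.toRepresentation.fixedPoints K)
    (W : Submodule ℂ H) (hWK : ∀ x ∈ K, ∀ w ∈ W, σ x w ∈ W)
    (hW0 : ∀ w ∈ W, w ∈ σ.toRepresentation.fixedPoints K → w = 0) {w : H} (hw : w ∈ W)
    (U : Subgroup K) (hUi : U.index ≠ 0) (hwU : ∀ u ∈ U, σ (u : G) w = w) :
    ⟪f, w⟫_ℂ = 0 := by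
  obtain ⟨s, hs, hsK, hsum⟩ :=
    exists_finset_sum_mem_fixedPoints σ.toRepresentation K U hUi (w := w) hwU
  have hmem : (∑ x ∈ s, (σ.toRepresentation) x w) ∈ W :=
    W.sum_mem fun x hx => hWK x (hsK x hx) w hw
  have h0 := hW0 _ hmem hsum
  have hinner : ⟪f, ∑ x ∈ s, (σ.toRepresentation) x w⟫_ℂ = (s.card : ℂ) * ⟪f, w⟫_ℂ := by
    rw [inner_sum, ← nsmul_eq_mul, ← Finset.sum_const]
    refine Finset.sum_congr rfl fun x hx => ?_
    exact inner_apply_eq_of_mem_fixedPoints σ hU K hf (hsK x hx) w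
  rw [h0, inner_zero_right] at hinner
  have hcard : (s.card : ℂ) ≠ 0 := Nat.cast_ne_zero.2 (Finset.card_pos.2 hs).ne'
  exact (mul_eq_zero.1 hinner.symm).resolve_left hcard

/-- **The `K`-fixed vectors of the cyclic module of a spherical Hecke eigenvector form the line
`ℂ f`.** Let `σ` be unitary, `K ≤ G` with finite double cosets, `f ∈ H^K` an eigenvector of all
`[KgK]`. Then for every `w ∈ span {σ(g) f}` there is `c` with `⟪z, w⟫ = c ⟪z, f⟫` for all
`z ∈ H^K` (`⟪z, σ(g) f⟫ = #(KgK/K)⁻¹ ⟪z, [KgK] f⟫`, `inner_heckeOperator_apply_left`); if `w`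
is itself `K`-fixed, `w = c • f` (Deitmar–Echterhoff (2014), Thm. 11.2.4 (b); Bump (1997),
Thm. 4.6.2; Cartier, Corvallis (1979), §IV). [folklore] -/
theorem exists_inner_eq_mul_inner_of_mem_span (σ : ContRepresentation ℂ G H) (hU : σ.IsUnitary)
    (K : Subgroup G) (hfin : ∀ g : G, (MulAction.orbit K (g : G ⧸ K)).Finite) {f : H}
    (hf : f ∈ σ.toRepresentation.fixedPoints K)
    (hscalar : ∀ g : G, ∃ c : ℂ, heckeOperator σ.toRepresentation K g f = c • f) {w : H}
    (hw : w ∈ Submodule.span ℂ (Set.range fun g : G => σ g f)) :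
    ∃ c : ℂ, ∀ z ∈ σ.toRepresentation.fixedPoints K, ⟪z, w⟫_ℂ = c * ⟪z, f⟫_ℂ := by
  induction hw using Submodule.span_induction with
  | mem x hx =>
    obtain ⟨g, rfl⟩ := hx
    obtain ⟨c, hc⟩ := hscalar g
    have hN : ((hfin g).toFinset.card : ℂ) ≠ 0 := by
      rw [Nat.cast_ne_zero, ← pos_iff_ne_zero, Finset.card_pos]
      exact ⟨(g : G ⧸ K), (Set.Finite.mem_toFinset _).2 (MulAction.mem_orbit_self _)⟩
    refine ⟨((hfin g).toFinset.card : ℂ)⁻¹ * c, fun z hz => ?_⟩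
    have h1 := inner_heckeOperator_apply_left σ hU K g (hfin g) hf hz
    rw [hc, inner_smul_left] at h1
    -- `h1 : conj c * ⟪f, z⟫ = N * ⟪σ g f, z⟫`; conjugate it
    have h1' := congrArg conj h1
    rw [map_mul, map_mul, Complex.conj_conj, inner_conj_symm, inner_conj_symm, map_natCast] at h1'
    have h2 : ⟪z, σ g f⟫_ℂ = ((hfin g).toFinset.card : ℂ)⁻¹ * (c * ⟪z, f⟫_ℂ) := by
      rw [eq_inv_mul_iff_mul_eq₀ hN]
      exact h1'.symm
    rw [h2, mul_assoc]
  | zero => exact ⟨0, fun z _ => by rw [inner_zero_right, zero_mul]⟩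
  | add x y _ _ hx hy =>
    obtain ⟨c₁, h₁⟩ := hx
    obtain ⟨c₂, h₂⟩ := hy
    exact ⟨c₁ + c₂, fun z hz => by rw [inner_add_right, h₁ z hz, h₂ z hz, add_mul]⟩
  | smul a x _ hx =>
    obtain ⟨c, hc⟩ := hx
    exact ⟨a * c, fun z hz => by rw [inner_smul_right, hc z hz, mul_assoc]⟩

/-- `S^K = ℂ f`: a `K`-fixed vector in the span of the translates of a spherical Hecke
eigenvector `f` of a unitary representation is a multiple of `f`
(Deitmar–Echterhoff (2014), Thm. 11.2.4 (b); Bump (1997), Thm. 4.6.2). [folklore] -/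
theorem exists_eq_smul_of_mem_span_of_mem_fixedPoints (σ : ContRepresentation ℂ G H)
    (hU : σ.IsUnitary) (K : Subgroup G) (hfin : ∀ g : G, (MulAction.orbit K (g : G ⧸ K)).Finite)
    {f : H} (hf : f ∈ σ.toRepresentation.fixedPoints K)
    (hscalar : ∀ g : G, ∃ c : ℂ, heckeOperator σ.toRepresentation K g f = c • f) {w : H}
    (hw : w ∈ Submodule.span ℂ (Set.range fun g : G => σ g f))
    (hwK : w ∈ σ.toRepresentation.fixedPoints K) : ∃ c : ℂ, w = c • f := by
  obtain ⟨c, hc⟩ := exists_inner_eq_mul_inner_of_mem_span σ hU K hfin hf hscalar hw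
  refine ⟨c, ?_⟩
  have hz : w - c • f ∈ σ.toRepresentation.fixedPoints K :=
    Submodule.sub_mem _ hwK (Submodule.smul_mem _ c hf)
  have h0 : ⟪w - c • f, w - c • f⟫_ℂ = 0 := by
    rw [inner_sub_right, inner_smul_right, hc _ hz, sub_self]
  rwa [inner_self_eq_zero, sub_eq_zero] at h0

/-- **The cyclic module of a spherical Hecke eigenvector of a unitary representation is an atom
of the lattice of subrepresentations.** Let `σ` be a unitary representation of `G` on a Hilbert
space, `K ≤ G` a subgroup with finite double cosets, `0 ≠ f ∈ H^K` an eigenvector of every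
Hecke operator `[KgK]`, and `S = span {σ(g) f}`. If `W < S` is a subrepresentation, either `W`
contains a non-zero `K`-fixed vector — a multiple of `f`
(`exists_eq_smul_of_mem_span_of_mem_fixedPoints`), forcing `W = S` — or `W^K = 0`, and then
`⟪f, w⟫ = 0` for all `w ∈ W` (`inner_eq_zero_of_forall_mem_fixedPoints_eq_zero`, the vectors
of `S` being fixed by finite-index subgroups of `K`), so `W ⊥ σ(G) f`, `W ⊥ S ⊇ W` and `W = 0`
(Deitmar–Echterhoff (2014), Thm. 11.2.4; Bump (1997), §3.3–3.4, Thm. 4.6.2; Cartier,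
Corvallis (1979), §IV). [cite: DeitmarEchterhoff2014, Thm. 11.2.4 (pp. 266–267)] -/
theorem isAtom_subrepresentation_span (σ : ContRepresentation ℂ G H) (hU : σ.IsUnitary)
    (K : Subgroup G) (hfin : ∀ g : G, (MulAction.orbit K (g : G ⧸ K)).Finite) {f : H}
    (hf : f ∈ σ.toRepresentation.fixedPoints K) (hf0 : f ≠ 0)
    (hscalar : ∀ g : G, ∃ c : ℂ, heckeOperator σ.toRepresentation K g f = c • f)
    (S : Subrepresentation σ.toRepresentation)
    (hS : S.toSubmodule = Submodule.span ℂ (Set.range fun g : G => σ g f)) : IsAtom S := by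
  classical
  have hfS : f ∈ S := mem_of_toSubmodule_eq_span hS
  refine ⟨fun hbot => hf0 ?_, fun W hWS => ?_⟩
  · rw [hbot] at hfS
    exact (Submodule.mem_bot ℂ).1 hfS
  by_contra hWne
  -- `W` contains no non-zero `K`-fixed vector
  have hW0 : ∀ w ∈ W, w ∈ σ.toRepresentation.fixedPoints K → w = 0 := by
    intro w hw hwK
    by_contra hw0
    have hwS : w ∈ Submodule.span ℂ (Set.range fun g : G => σ g f) := by
      rw [← hS]
      exact hWS.1 hw
    obtain ⟨c, rfl⟩ := exists_eq_smul_of_mem_span_of_mem_fixedPoints σ hU K hfin hf hscalar hwS hwK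
    have hc : c ≠ 0 := by
      rintro rfl
      exact hw0 (zero_smul _ _)
    have hfW : f ∈ W := by
      have : c⁻¹ • c • f ∈ W.toSubmodule := W.toSubmodule.smul_mem c⁻¹ hw
      rwa [smul_smul, inv_mul_cancel₀ hc, one_smul] at this
    exact hWS.2 (le_of_toSubmodule_eq_span hS W hfW)
  -- hence `⟪f, w⟫ = 0` for every `w ∈ W`
  have hWK : ∀ x ∈ K, ∀ w ∈ W.toSubmodule, σ x w ∈ W.toSubmodule :=
    fun x _ w hw => W.apply_mem_toSubmodule x hw
  have horth : ∀ w ∈ W, ⟪f, w⟫_ℂ = 0 := by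
    intro w hw
    have hwS : w ∈ Submodule.span ℂ (Set.range fun g : G => σ g f) := by
      rw [← hS]
      exact hWS.1 hw
    obtain ⟨U, hUi, hwU⟩ :=
      exists_subgroup_index_ne_zero_of_mem_span σ.toRepresentation K hfin hf hwS
    exact inner_eq_zero_of_forall_mem_fixedPoints_eq_zero σ hU K hf W.toSubmodule hWK hW0 hw U
      hUi hwU
  -- so every `w ∈ W` is orthogonal to `S ∋ w`
  apply hWne
  refine le_antisymm (fun w hw => ?_) bot_le
  have hwS : w ∈ Submodule.span ℂ (Set.range fun g : G => σ g f) := by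
    rw [← hS]
    exact hWS.1 hw
  have key : ∀ x ∈ Submodule.span ℂ (Set.range fun g : G => σ g f), ⟪x, w⟫_ℂ = 0 := by
    intro x hx
    induction hx using Submodule.span_induction with
    | mem x hx =>
      obtain ⟨g, rfl⟩ := hx
      rw [inner_apply_left_eq σ hU g f w]
      exact horth _ (W.apply_mem_toSubmodule g⁻¹ hw)
    | zero => exact inner_zero_left _
    | add x y _ _ hx hy => rw [inner_add_left, hx, hy, add_zero]
    | smul a x _ hx => rw [inner_smul_left, hx, mul_zero]
  have h0 : ⟪w, w⟫_ℂ = 0 := key w hwS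
  rw [inner_self_eq_zero] at h0
  rw [h0]
  exact (Submodule.mem_bot ℂ).2 rfl

/-- **The cyclic module of a spherical Hecke eigenvector of a unitary representation is
irreducible** (as an abstract representation of `G`): `isAtom_subrepresentation_span` through
`Subrepresentation.isIrreducible_toRepresentation_iff_isAtom`
(Deitmar–Echterhoff (2014), Thm. 11.2.4; Bump (1997), Thm. 4.6.2; Cartier, Corvallis (1979),
§IV). [cite: DeitmarEchterhoff2014, Thm. 11.2.4 (pp. 266–267)] -/
theorem isIrreducible_toRepresentation_span (σ : ContRepresentation ℂ G H) (hU : σ.IsUnitary)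
    (K : Subgroup G) (hfin : ∀ g : G, (MulAction.orbit K (g : G ⧸ K)).Finite) {f : H}
    (hf : f ∈ σ.toRepresentation.fixedPoints K) (hf0 : f ≠ 0)
    (hscalar : ∀ g : G, ∃ c : ℂ, heckeOperator σ.toRepresentation K g f = c • f)
    (S : Subrepresentation σ.toRepresentation)
    (hS : S.toSubmodule = Submodule.span ℂ (Set.range fun g : G => σ g f)) :
    S.toRepresentation.IsIrreducible :=
  (Literature.RepresentationTheory.Semisimple.Subrepresentation.isIrreducible_toRepresentation_iff_isAtom
    S).2 (isAtom_subrepresentation_span σ hU K hfin hf hf0 hscalar S hS)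

/-- Summary form: a non-zero spherical Hecke eigenvector `f ∈ H^K` of a unitary representation
`σ` generates an irreducible subrepresentation `S ∋ f`, smooth when `K` is open, whose `K`-fixed
vectors are the multiples of `f` (Deitmar–Echterhoff (2014), Thm. 11.2.4; Bump (1997), §3.3–3.4).
[folklore] -/
theorem exists_isIrreducible_subrepresentation_of_heckeEigenvector [TopologicalSpace G]
    [SeparatelyContinuousMul G] (σ : ContRepresentation ℂ G H) (hU : σ.IsUnitary)
    (K : Subgroup G) (hK : IsOpen (K : Set G))
    (hfin : ∀ g : G, (MulAction.orbit K (g : G ⧸ K)).Finite) {f : H}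
    (hf : f ∈ σ.toRepresentation.fixedPoints K) (hf0 : f ≠ 0)
    (hscalar : ∀ g : G, ∃ c : ℂ, heckeOperator σ.toRepresentation K g f = c • f) :
    ∃ S : Subrepresentation σ.toRepresentation, f ∈ S ∧
      S.toSubmodule = Submodule.span ℂ (Set.range fun g : G => σ g f) ∧
      S.toRepresentation.IsIrreducible ∧ S.toRepresentation.IsSmooth ∧
      ∀ w ∈ S, w ∈ σ.toRepresentation.fixedPoints K → ∃ c : ℂ, w = c • f := by
  obtain ⟨S, hS'⟩ := exists_subrepresentation_toSubmodule_eq_span σ.toRepresentation f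
  have hS : S.toSubmodule = Submodule.span ℂ (Set.range fun g : G => σ g f) := hS'
  refine ⟨S, mem_of_toSubmodule_eq_span hS, hS,
    isIrreducible_toRepresentation_span σ hU K hfin hf hf0 hscalar S hS,
    isSmooth_toRepresentation_span σ.toRepresentation K hK hf S hS, fun w hw hwK => ?_⟩
  refine exists_eq_smul_of_mem_span_of_mem_fixedPoints σ hU K hfin hf hscalar ?_ hwK
  rw [← hS]
  exact hw

end Unitary

end Literature.NumberTheory.Automorphic
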